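import Summits.FinalStateConjecture.FinalStateConjecture.Theorems.PhotonSphereChannelsChannelsResolveTameDevelopmentsRPotentialRepulsion

/-!
# Crux `WindowedShellChannels` (stmt-FinalStateConjecture-14085), line `Sketch`, stub `stub_peakShape` —
# the shape of the unit-mass Regge–Wheeler potentials on the centred tortoise line

The registered stub `stub_peakShape` of line `Sketch`, over the Literature vocabulary
`ReggeWheeler.{rwPotential, linePotential, tortoiseRadius, IsTortoiseRadius, tortoiseCoord}`.  For the
unit mass `M = 1`, the centred tortoise radius function `r = tortoiseRadius one_pos 0` (`r > 2`,
`r′ = 1 − 2/r`, `r 0 = 3`) and every spin `s ≤ 2` and angular number `ℓ ≥ s`, the line potential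
`V = V_{s,ℓ} ∘ r` is `C¹`, satisfies `|V′| ≤ K V` with ONE constant (`K = 12`) for all `(s, ℓ)`, and is
single-peaked: `(x − x_p) V′(x) ≤ 0` for a peak position `|x_p| ≤ X` (`X = 3`), uniformly in `(s, ℓ)`.

Proof (sub-namespace `PeakShape`; `λ = ℓ(ℓ+1)`, `σ = 2(1 − s²) ∈ {2, 0, −6}`, `ρ = r(x) > 2`):

* `PeakShape.linePotential_eq`, `PeakShape.deriv_linePotential_eq` — the closed forms
  `V = (ρ − 2)(λρ + σ)/ρ⁴` and (chain rule `RW.hasDerivAt_linePotential`)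
  `V′ = (ρ − 2) p(ρ)/ρ⁶`, `p(ρ) = −2λρ² + (6λ − 3σ)ρ + 8σ`;
* `PeakShape.sig_cases` — the three admissible cases `σ = 2`, `σ = 0 ∧ λ ≥ 2`, `σ = −6 ∧ λ ≥ 6`; the
  polynomial facts below are proved for abstract real parameters `L ≥ 0`, `σ` in one of these cases;
* `PeakShape.abs_poly_le` — `|p(ρ)| ≤ 12 ρ²(λρ + σ)` for `ρ ≥ 2`, whence `|V′| ≤ 12 V`
  (`PeakShape.abs_deriv_le`);
* `PeakShape.exists_root` — `p(5/2) = (5λ + σ)/2 ≥ 0 ≥ −(7λ + 5σ)/2 = p(7/2)`, so (intermediate value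
  theorem) `p` has a zero `ρ_p ∈ [5/2, 7/2]`, and `p(ρ) = (ρ − ρ_p) q(ρ)` with
  `q(ρ) = −2λ(ρ + ρ_p) + 6λ − 3σ ≤ −3(λ + σ) ≤ 0` on `ρ ≥ 2`: `(ρ − ρ_p) p(ρ) ≤ 0`;
* `PeakShape.exists_peak` — with `x_p = r⁻¹(ρ_p)` (`IsTortoiseRadius.range_eq`, `strictMono`):
  `(x − x_p) V′(x) ≤ 0`; and `PeakShape.abs_sub_le` — `x_p − x_c = r*(ρ_p) = ρ_p − 3 + 2 log(ρ_p − 2)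
  ∈ [−5/2, 3/2]` (`IsTortoiseRadius.tortoiseCoord_eq`, `log y ≤ y − 1`, `1 − 1/y ≤ log y`).

Standard calculus [folklore]; no new definitions.
-/

noncomputable section

-- the tree's namespace `Summit.FinalStateConjecture.FinalStateConjecture.Theorems` repeats a component by design
-- (problem directory `Summits/FinalStateConjecture/FinalStateConjecture/…`), as in every landed file of this line
set_option linter.dupNamespace false

namespace Summit.FinalStateConjecture.FinalStateConjecture.Theorems.WindowedShellChannelsSketch

open Literature.Geometry.Lorentzian Literature.Geometry.Lorentzian.ReggeWheeler Filter Set MeasureTheory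
open scoped ENNReal Topology

namespace PeakShape

/-! ### The numerator polynomial `p(ρ) = −2Lρ² + (6L − 3σ)ρ + 8σ`: elementary algebra -/

/-- The three admissible cases of `(σ, λ) = (2(1 − s²), ℓ(ℓ+1))` for `s ≤ 2`, `s ≤ ℓ`:
`s = 0`: `σ = 2`; `s = 1 ≤ ℓ`: `σ = 0`, `λ ≥ 2`; `s = 2 ≤ ℓ`: `σ = −6`, `λ ≥ 6`. [folklore] -/
theorem sig_cases {s ℓ : ℕ} (hs : s ≤ 2) (hsℓ : s ≤ ℓ) :
    2 * (1 - (s : ℝ) ^ 2) = 2 ∨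
      (2 * (1 - (s : ℝ) ^ 2) = 0 ∧ 2 ≤ (ℓ : ℝ) * ((ℓ : ℝ) + 1)) ∨
      (2 * (1 - (s : ℝ) ^ 2) = -6 ∧ 6 ≤ (ℓ : ℝ) * ((ℓ : ℝ) + 1)) := by
  interval_cases s
  · left
    norm_num
  · right; left
    have h1 : (1 : ℝ) ≤ ℓ := by exact_mod_cast hsℓ
    refine ⟨by norm_num, ?_⟩
    nlinarith
  · right; right
    have h2 : (2 : ℝ) ≤ ℓ := by exact_mod_cast hsℓ
    refine ⟨by norm_num, ?_⟩
    nlinarith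

/-- **The derivative bound, polynomial form**: `|p(ρ)| ≤ 12 ρ² (Lρ + σ)` for `ρ ≥ 2`, `L ≥ 0` and
`(σ, L)` admissible. [folklore] -/
theorem abs_poly_le {L σ ρ : ℝ} (hL : 0 ≤ L) (hρ : 2 ≤ ρ)
    (hcase : σ = 2 ∨ (σ = 0 ∧ 2 ≤ L) ∨ (σ = -6 ∧ 6 ≤ L)) :
    |-2 * L * ρ ^ 2 + (6 * L - 3 * σ) * ρ + 8 * σ| ≤ 12 * (ρ ^ 2 * (L * ρ + σ)) := by
  have hρ0 : 0 ≤ ρ := by linarith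
  have P2 : 0 ≤ L * ρ * (ρ - 2) := mul_nonneg (mul_nonneg hL hρ0) (by linarith)
  have P3 : 0 ≤ L * ρ ^ 2 * (ρ - 2) := mul_nonneg (mul_nonneg hL (by positivity)) (by linarith)
  have P4 : 0 ≤ (ρ - 2) ^ 2 := sq_nonneg _
  have P5 : 0 ≤ L * ρ := mul_nonneg hL hρ0
  have P6 : 0 ≤ L * ρ ^ 2 := by positivity
  have P7 : 0 ≤ ρ ^ 2 * (ρ - 2) := mul_nonneg (by positivity) (by linarith)
  rcases hcase with hσ | ⟨hσ, -⟩ | ⟨hσ, h6⟩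
  · rw [hσ, abs_le]
    constructor <;> nlinarith [P2, P3, P4, P5, P6]
  · rw [hσ, abs_le]
    constructor <;> nlinarith [P2, P3, P4, P5, P6]
  · rw [hσ, abs_le]
    have Q1 : 0 ≤ 12 * ρ ^ 3 + 2 * ρ ^ 2 - 6 * ρ := by nlinarith [P4, P7]
    have Q2 : 0 ≤ 12 * ρ ^ 3 - 2 * ρ ^ 2 + 6 * ρ := by nlinarith [P4, P7]
    have P8 : 0 ≤ (L - 6) * (12 * ρ ^ 3 + 2 * ρ ^ 2 - 6 * ρ) := mul_nonneg (by linarith) Q1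
    have P9 : 0 ≤ (L - 6) * (12 * ρ ^ 3 - 2 * ρ ^ 2 + 6 * ρ) := mul_nonneg (by linarith) Q2
    constructor <;> nlinarith [P4, P7, P8, P9]

/-- **The single sign change of `p`**: for `L ≥ 0` and `(σ, L)` admissible there is `ρ_p ∈ [5/2, 7/2]`
with `(ρ − ρ_p) p(ρ) ≤ 0` for all `ρ ≥ 2` (`p(5/2) = (5L + σ)/2 ≥ 0`, `p(7/2) = −(7L + 5σ)/2 ≤ 0`,
intermediate value theorem, and `p(ρ) = (ρ − ρ_p)(−2L(ρ + ρ_p) + 6L − 3σ)` with a non-positive second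
factor on `ρ ≥ 2`). [folklore] -/
theorem exists_root {L σ : ℝ} (hL : 0 ≤ L) (hcase : σ = 2 ∨ (σ = 0 ∧ 2 ≤ L) ∨ (σ = -6 ∧ 6 ≤ L)) :
    ∃ ρp : ℝ, 5 / 2 ≤ ρp ∧ ρp ≤ 7 / 2 ∧
      ∀ ρ, 2 ≤ ρ → (ρ - ρp) * (-2 * L * ρ ^ 2 + (6 * L - 3 * σ) * ρ + 8 * σ) ≤ 0 := by
  have hLσ : 0 ≤ L + σ ∧ 0 ≤ 7 * L + 5 * σ := by
    rcases hcase with h | ⟨h, h'⟩ | ⟨h, h'⟩ <;> rw [h] <;> constructor <;> linarith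
  set p : ℝ → ℝ := fun ρ => -2 * L * ρ ^ 2 + (6 * L - 3 * σ) * ρ + 8 * σ with hp
  have hcont : Continuous p := by
    rw [hp]
    fun_prop
  have h52 : 0 ≤ p (5 / 2) := by
    have e : p (5 / 2) = (5 * L + σ) / 2 := by
      simp only [hp]
      ring
    rw [e]
    linarith
  have h72 : p (7 / 2) ≤ 0 := by
    have e : p (7 / 2) = -(7 * L + 5 * σ) / 2 := by
      simp only [hp]
      ring
    rw [e]
    linarith
  obtain ⟨ρp, ⟨h1, h2⟩, hroot⟩ :=
    intermediate_value_Icc' (show (5 / 2 : ℝ) ≤ 7 / 2 by norm_num) hcont.continuousOn ⟨h72, h52⟩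
  refine ⟨ρp, h1, h2, fun ρ hρ => ?_⟩
  show (ρ - ρp) * p ρ ≤ 0
  have hq : p ρ = (ρ - ρp) * (-2 * L * (ρ + ρp) + (6 * L - 3 * σ)) := by
    have e : p ρ = p ρ - p ρp := by rw [hroot, sub_zero]
    rw [e]
    simp only [hp]
    ring
  have hqneg : -2 * L * (ρ + ρp) + (6 * L - 3 * σ) ≤ 0 := by
    have P : 0 ≤ L * (ρ + ρp - 9 / 2) := mul_nonneg hL (by linarith)
    nlinarith [P]
  rw [hq, ← mul_assoc]
  exact mul_nonpos_iff.2 (Or.inl ⟨mul_self_nonneg _, hqneg⟩)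

/-! ### Along a unit-mass tortoise radius function -/

variable {r : ℝ → ℝ} {xc : ℝ}

/-- Closed form of the potential on the line: `V(x) = (ρ − 2)(λρ + σ)/ρ⁴`, `ρ = r(x)`, `λ = ℓ(ℓ+1)`,
`σ = 2(1 − s²)`. [folklore] -/
theorem linePotential_eq (hr : IsTortoiseRadius 1 r xc) (s ℓ : ℕ) (x : ℝ) :
    linePotential 1 s ℓ r x
      = (r x - 2) * ((ℓ : ℝ) * ((ℓ : ℝ) + 1) * r x + 2 * (1 - (s : ℝ) ^ 2)) / r x ^ 4 := by
  have hρ : r x ≠ 0 := (hr.pos x).ne'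
  rw [linePotential_apply]
  unfold rwPotential
  field_simp

/-- Closed form of the derivative on the line: `V′(x) = (ρ − 2) p(ρ)/ρ⁶`, `ρ = r(x)`,
`p(ρ) = −2λρ² + (6λ − 3σ)ρ + 8σ` (chain rule with `r′ = 1 − 2/r`). [folklore] -/
theorem deriv_linePotential_eq (hr : IsTortoiseRadius 1 r xc) (s ℓ : ℕ) (x : ℝ) :
    deriv (linePotential 1 s ℓ r) x
      = (r x - 2) * (-2 * ((ℓ : ℝ) * ((ℓ : ℝ) + 1)) * r x ^ 2
          + (6 * ((ℓ : ℝ) * ((ℓ : ℝ) + 1)) - 3 * (2 * (1 - (s : ℝ) ^ 2))) * r x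
          + 8 * (2 * (1 - (s : ℝ) ^ 2))) / r x ^ 6 := by
  have hρ : r x ≠ 0 := (hr.pos x).ne'
  rw [(RW.hasDerivAt_linePotential hr s ℓ x).deriv]
  field_simp
  ring

/-- **`|V′| ≤ 12 V`** along a unit-mass tortoise radius function, for `s ≤ 2`, `s ≤ ℓ`. [folklore] -/
theorem abs_deriv_le (hr : IsTortoiseRadius 1 r xc) {s ℓ : ℕ} (hs : s ≤ 2) (hsℓ : s ≤ ℓ) (x : ℝ) :
    |deriv (linePotential 1 s ℓ r) x| ≤ 12 * linePotential 1 s ℓ r x := by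
  rw [deriv_linePotential_eq hr, linePotential_eq hr]
  set L : ℝ := (ℓ : ℝ) * ((ℓ : ℝ) + 1) with hL
  set σ : ℝ := 2 * (1 - (s : ℝ) ^ 2) with hσ
  have hL0 : 0 ≤ L := by positivity
  have hρ0 : 0 < r x := hr.pos x
  have h2 : 2 < r x := by
    have := hr.two_mul_lt x
    linarith
  have hp := abs_poly_le hL0 h2.le (sig_cases hs hsℓ)
  rw [abs_div, abs_mul, abs_of_pos (sub_pos.2 h2), abs_of_pos (pow_pos hρ0 6),
    div_le_iff₀ (pow_pos hρ0 6)]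
  have e : 12 * ((r x - 2) * (L * r x + σ) / r x ^ 4) * r x ^ 6
      = (r x - 2) * (12 * (r x ^ 2 * (L * r x + σ))) := by
    field_simp
  rw [e]
  exact mul_le_mul_of_nonneg_left hp (sub_pos.2 h2).le

/-- **Single peak**: there is `x_p` with `r(x_p) ∈ [5/2, 7/2]` and `(x − x_p) V′(x) ≤ 0` for all `x`
(`sign V′(x) = sign p(r x) = sign (ρ_p − r x) = sign (x_p − x)` by strict monotonicity of `r`). [folklore] -/
theorem exists_peak (hr : IsTortoiseRadius 1 r xc) {s ℓ : ℕ} (hs : s ≤ 2) (hsℓ : s ≤ ℓ) :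
    ∃ xp : ℝ, 5 / 2 ≤ r xp ∧ r xp ≤ 7 / 2 ∧
      ∀ x, (x - xp) * deriv (linePotential 1 s ℓ r) x ≤ 0 := by
  have hL0 : 0 ≤ (ℓ : ℝ) * ((ℓ : ℝ) + 1) := by positivity
  obtain ⟨ρp, h1, h2, hsign⟩ := exists_root hL0 (sig_cases hs hsℓ)
  have hmem : ρp ∈ Set.range r := by
    rw [hr.range_eq]
    exact Set.mem_Ioi.2 (by linarith)
  obtain ⟨xp, hxp⟩ := hmem
  refine ⟨xp, hxp ▸ h1, hxp ▸ h2, fun x => ?_⟩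
  rw [deriv_linePotential_eq hr]
  set L : ℝ := (ℓ : ℝ) * ((ℓ : ℝ) + 1) with hL
  set σ : ℝ := 2 * (1 - (s : ℝ) ^ 2) with hσ
  set P : ℝ := -2 * L * r x ^ 2 + (6 * L - 3 * σ) * r x + 8 * σ with hP
  have hρ0 : 0 < r x := hr.pos x
  have h2x : 2 < r x := by
    have := hr.two_mul_lt x
    linarith
  have hpx : (r x - ρp) * P ≤ 0 := hsign (r x) h2x.le
  have key : (x - xp) * P ≤ 0 := by
    rcases lt_trichotomy (r x) ρp with hlt | heq | hgt
    · have hx : x < xp := hr.strictMono.lt_iff_lt.1 (hxp ▸ hlt)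
      have hp : 0 ≤ P := by
        rcases mul_nonpos_iff.1 hpx with ⟨h, _⟩ | ⟨_, h⟩
        · linarith
        · exact h
      exact mul_nonpos_iff.2 (Or.inr ⟨by linarith, hp⟩)
    · have hx : x = xp := hr.strictMono.injective (heq.trans hxp.symm)
      rw [hx, sub_self, zero_mul]
    · have hx : xp < x := hr.strictMono.lt_iff_lt.1 (hxp ▸ hgt)
      have hp : P ≤ 0 := by
        rcases mul_nonpos_iff.1 hpx with ⟨_, h⟩ | ⟨h, _⟩
        · exact h
        · linarith
      exact mul_nonpos_iff.2 (Or.inl ⟨by linarith, hp⟩)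
  have hw : 0 ≤ (r x - 2) / r x ^ 6 := div_nonneg (by linarith) (by positivity)
  calc (x - xp) * ((r x - 2) * P / r x ^ 6)
      = (x - xp) * P * ((r x - 2) / r x ^ 6) := by ring
    _ ≤ 0 := mul_nonpos_iff.2 (Or.inr ⟨key, hw⟩)

/-- **Position of the peak**: if `r(x_p) ∈ [5/2, 7/2]` then `|x_p − x_c| ≤ 3`, since
`x_p − x_c = r*(r(x_p)) = ρ − 3 + 2 log(ρ − 2)` with `ρ − 2 ∈ [1/2, 3/2]` and `−1 ≤ log(ρ − 2) ≤ 1/2`.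
[folklore] -/
theorem abs_sub_le (hr : IsTortoiseRadius 1 r xc) {xp : ℝ} (h1 : 5 / 2 ≤ r xp) (h2 : r xp ≤ 7 / 2) :
    |xp - xc| ≤ 3 := by
  rw [← hr.tortoiseCoord_eq xp]
  have e : tortoiseCoord 1 (r xp) = r xp - 3 + 2 * Real.log (r xp - 2) := by
    unfold tortoiseCoord
    rw [Real.log_one]
    ring_nf
  rw [e]
  have hy : 0 < r xp - 2 := by linarith
  have hup : Real.log (r xp - 2) ≤ r xp - 2 - 1 := Real.log_le_sub_one_of_pos hy
  have hlow : 1 - (r xp - 2)⁻¹ ≤ Real.log (r xp - 2) := Real.one_sub_inv_le_log_of_pos hy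
  have hinv : (r xp - 2)⁻¹ ≤ 2 := by
    rw [inv_le_comm₀ hy two_pos]
    linarith [show (2 : ℝ)⁻¹ = 1 / 2 by norm_num]
  rw [abs_le]
  constructor <;> linarith [hup, hlow, hinv]

end PeakShape

/-- **Shape of the unit-mass Regge–Wheeler potentials on the centred tortoise line** (registered stub
`stub_peakShape` of line `Sketch`, crux stmt-FinalStateConjecture-14085).  With `K = 12` and `X = 3`:
for every `s ≤ 2`, `s ≤ ℓ`, the potential `V = V_{s,ℓ} ∘ r`, `r = tortoiseRadius one_pos 0`, is
differentiable with `HasDerivAt V (deriv V x) x` and continuous `deriv V` (`RW.differentiable_linePotential`,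
`RW.contDiff_one_linePotential`), `|V′| ≤ K V` (`PeakShape.abs_deriv_le`), and there is a peak position
`|x_p| ≤ X` with `(x − x_p) V′(x) ≤ 0` for all `x` (`PeakShape.exists_peak`, `PeakShape.abs_sub_le`).
[folklore] -/
theorem stub_peakShape : ∃ K : ℝ, 0 ≤ K ∧ ∃ X : ℝ, 0 ≤ X ∧ ∀ (s ℓ : ℕ), s ≤ 2 → s ≤ ℓ →
    (∀ x, HasDerivAt (linePotential 1 s ℓ (tortoiseRadius one_pos 0))
      (deriv (linePotential 1 s ℓ (tortoiseRadius one_pos 0)) x) x) ∧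
    Continuous (deriv (linePotential 1 s ℓ (tortoiseRadius one_pos 0))) ∧
    (∀ x, |deriv (linePotential 1 s ℓ (tortoiseRadius one_pos 0)) x|
      ≤ K * linePotential 1 s ℓ (tortoiseRadius one_pos 0) x) ∧
    ∃ xp : ℝ, |xp| ≤ X ∧
      ∀ x, (x - xp) * deriv (linePotential 1 s ℓ (tortoiseRadius one_pos 0)) x ≤ 0 := by
  have hr : IsTortoiseRadius 1 (tortoiseRadius one_pos 0) 0 := isTortoiseRadius_tortoiseRadius one_pos 0
  refine ⟨12, by norm_num, 3, by norm_num, fun s ℓ hs hsℓ => ⟨?_, ?_, ?_, ?_⟩⟩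
  · exact fun x => ((RW.differentiable_linePotential hr s ℓ) x).hasDerivAt
  · exact (RW.contDiff_one_linePotential hr s ℓ).continuous_deriv le_rfl
  · exact fun x => PeakShape.abs_deriv_le hr hs hsℓ x
  · obtain ⟨xp, h1, h2, hmono⟩ := PeakShape.exists_peak hr hs hsℓ
    exact ⟨xp, by simpa using PeakShape.abs_sub_le hr h1 h2, hmono⟩

end Summit.FinalStateConjecture.FinalStateConjecture.Theorems.WindowedShellChannelsSketch

end
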